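import Summits.AtomisticToContinuum.Crystallization.Theorems.NashClassCertificatesNashHullBridge

/-!
# Crux `HullMinimality.LayeredWindows` (stmt-AtomisticToContinuum-11778), line `registered`:
# the FREQUENTLY-in-`N` form of stub S1 suffices (lead c4)

The landed bridge `LayeredWindowsLocal.layeredWindows_of_goodWindows` consumes stub S1 in the form "for every
radius `ρ`, EVENTUALLY in `N`, some particle of the `N`-th ground state has an all-two-shell-good `ρ`-ball".  The
crux only asks for windows FREQUENTLY in `N`, and the whole chain is pointwise in `N` except for the final
accumulation-point argument, which runs equally well along a subsequence.  This file records that: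

* `cleanCentre_of_goodBall` — the POINTWISE core of the localised clean-centre argument (`cleanCentres_of` with the
  `N`-filter stripped): under `NashNearField`, for every `(η, R')` there is a radius `ρ` such that in EVERY
  Lennard-Jones ground state, every all-two-shell-good `ρ`-ball contains a particle whose `R'`-ball is all-`Good`
  and all-`LayeredNear η` (same proof: local excess + `E(n)/n → e*` + boundary layer against the volume count);
* `cleanCentres_freq_of` — hence all-good balls frequently give clean centres frequently;
* `hb_exists_global_spacing_freq`, `windowsOfGluing_freq` — the accumulation-point argument of
  `hb_exists_global_spacing` / `HullBridgeExact.stub_windowsOfGluing` from windows existing FREQUENTLY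
  (`Filter.extraction_forall_of_frequently` in place of `…_of_eventually`);
* `layeredWindows_seq_of_goodWindows_freq`, `layeredWindows_of_goodWindows_freq` — the bridge from the weaker,
  frequently-in-`N` form of S1 (and `NashNearField`) to `HullMinimality.LayeredWindows` BY NAME.

Together with the necessity direction (`LayeredWindows` ⇒ all-good balls frequently, file
`HullMinimalityLayeredWindowsNecessity`), this pins the positional leaf of the line: modulo `NashNearField` the
crux is EQUIVALENT to the frequently-form of S1.
-/

noncomputable section

open scoped BigOperators Classical InnerProductSpace
open Filter Topology

namespace Summit.AtomisticToContinuum.Crystallization.Theorems.LayeredWindowsLocal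

open Summit.AtomisticToContinuum.Crystallization.Theses
open Summit.AtomisticToContinuum.Crystallization.Theorems.PrestressSplitKorn
open Summit.AtomisticToContinuum.Crystallization.Theorems.DefectFreeCrystallizes.Negative.PredicateAPI (Good)
open Literature.MathematicalPhysics.StatisticalMechanics Literature.Geometry.DiscreteGeometry
open Summit.AtomisticToContinuum.Crystallization.Theorems.ChargedEnergyGapNegative (E3)

/-! ## The pointwise clean-centre lemma -/
set_option maxHeartbeats 400000 in
/-- **Clean centre inside an all-good ball (pointwise in the configuration).** Under `NashNearField` (item
16827), for every `η > 0` and `R'` there is a radius `ρ` such that: in every Lennard-Jones ground state `y`, if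
every particle within `ρ` of `y i₀` is two-shell good, then some particle has its whole `R'`-ball `Good` and
`LayeredNear η`.  (The proof of `cleanCentres_of`, which is pointwise in `N`: `NashNearField` on `Ω =` the
particles of the ball bounds `c·#{non-η-layered in Ω}` by the local excess `≤ θ#Ω + Cρ²` plus the boundary layer
`≤ 11664ρ²`, too few `R'`-neighbourhoods to cover the `≥ (ρ/(4r₀))³` particles of the half ball.) -/
theorem cleanCentre_of_goodBall (hNF : Summit.AtomisticToContinuum.Crystallization.Theses.NashClassCertificates.NashNearField) :
    ∀ η : ℝ, 0 < η → ∀ R' : ℝ, ∃ ρ : ℝ, ∀ (N : ℕ) (y : Fin N → E3), IsGroundState lennardJones y →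
      ∀ i₀ : Fin N, (∀ j : Fin N, dist (y j) (y i₀) ≤ ρ → IsTwoShellGood (1 / 20) (47 / 50) 1 y j) →
        ∃ i : Fin N, ∀ j : Fin N, dist (y j) (y i) ≤ R' → Good y j ∧ LayeredNear η y j := by
  intro η hη R'
  classical
  set R₀ : ℝ := max R' 0 with hR₀
  have hR₀0 : 0 ≤ R₀ := le_max_right _ _
  have hR'R₀ : R' ≤ R₀ := le_max_left _ _
  obtain ⟨c, hc, Cnf, hNF⟩ := hNF η hη
  obtain ⟨C₄, hC₄⟩ := stub_localExcess
  obtain ⟨r₀, hr₀1, hdense⟩ := stub_goodRegionDense (2 / 11) (by norm_num) stub_patternCovering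
  have hr₀ : 0 < r₀ := by linarith
  obtain ⟨K₁, hK₁def⟩ : ∃ K₁ : ℝ, K₁ = (6 * R₀ + 1) ^ 3 / c := ⟨_, rfl⟩
  have hK₁ : 0 < K₁ := by rw [hK₁def]; positivity
  obtain ⟨C₅, hC₅def⟩ : ∃ C₅ : ℝ, C₅ = max C₄ 0 + max Cnf 0 * 11664 := ⟨_, rfl⟩
  have hC₅ : 0 ≤ C₅ := by rw [hC₅def]; positivity
  obtain ⟨θ, hθ0, hθK⟩ : ∃ θ : ℝ, 0 < θ ∧ K₁ * θ * 343 ≤ 1 / (128 * r₀ ^ 3) := by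
    refine ⟨1 / (43904 * r₀ ^ 3 * K₁ + 1), by positivity, ?_⟩
    rw [le_div_iff₀ (by positivity)]
    have h1 : 1 / (43904 * r₀ ^ 3 * K₁ + 1) * (43904 * r₀ ^ 3 * K₁ + 1) = 1 := by field_simp
    have h2 : K₁ * (1 / (43904 * r₀ ^ 3 * K₁ + 1)) * 343 * (128 * r₀ ^ 3) =
        1 / (43904 * r₀ ^ 3 * K₁ + 1) * (43904 * r₀ ^ 3 * K₁ + 1) - 1 / (43904 * r₀ ^ 3 * K₁ + 1) := by ring
    have h3 : 0 < 1 / (43904 * r₀ ^ 3 * K₁ + 1) := by positivity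
    rw [h2]
    linarith
  obtain ⟨N₀, hN₀⟩ := energy_budget_eventually hθ0
  obtain ⟨ρ, hρ1, hρ2, hρ3⟩ : ∃ ρ : ℝ, 4 * r₀ * ((N₀ : ℝ) + 1) ≤ ρ ∧ 2 * R₀ + 1 ≤ ρ ∧
      128 * r₀ ^ 3 * K₁ * C₅ + 1 ≤ ρ :=
    ⟨max (max (4 * r₀ * ((N₀ : ℝ) + 1)) (2 * R₀ + 1)) (128 * r₀ ^ 3 * K₁ * C₅ + 1),
      (le_max_left _ _).trans (le_max_left _ _), (le_max_right _ _).trans (le_max_left _ _), le_max_right _ _⟩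
  have hN₀nn : (0 : ℝ) ≤ N₀ := Nat.cast_nonneg _
  have hρ4r₀ : 4 * r₀ ≤ ρ := by nlinarith
  have hρone : 1 ≤ ρ := by linarith
  have hρpos : 0 < ρ := by linarith
  refine ⟨ρ, fun N xc hxc i₀ hi₀ => ?_⟩
  have hinj : Function.Injective (xc) := hxc.1
  have hsep : ∀ i j : Fin N, i ≠ j → (1 / 3 : ℝ) ≤ dist (xc i) (xc j) := fun i j hij =>
    ZeroDefectDensity.third_le_dist_of_isGroundState hxc hij
  have hnash := stub_groundStatesAreNash N (xc) hxc
  have hloc := hC₄ N (xc) hxc (xc i₀) ρ hρone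
  set Ω := Finset.univ.filter fun i : Fin N => dist (xc i) (xc i₀) ≤ ρ with hΩ
  have hΩgood : ∀ i ∈ Ω, IsTwoShellGood (1 / 20) (47 / 50) 1 (xc) i := fun i hi =>
    hi₀ i (Finset.mem_filter.1 hi).2
  have hnf0 := hNF N (xc) hsep hnash Ω hΩgood
  rw [HullBridgeExact.nl_card_inline_eq η (xc) Ω, HullBridgeExact.nl_card_bdry_eq (xc) Ω 4] at hnf0
  set e : ℝ := ⨅ Q : PeriodicConfiguration 3, Q.energyPerParticle lennardJones with he
  have hsum : ∑ i ∈ Ω, ((1 / 2 : ℝ) * (∑ j ∈ Finset.univ.erase i, lennardJones (dist (xc i) (xc j))) - e) =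
      (∑ i ∈ Ω, (1 / 2 : ℝ) * siteEnergy lennardJones (xc) i) - (Ω.card : ℝ) * e := by
    rw [Finset.sum_sub_distrib, Finset.sum_const, nsmul_eq_mul]
    rfl
  rw [hsum] at hnf0
  set D := Ω.filter fun i => ¬ LayeredNear η (xc) i with hD
  set Bd := Ω.filter fun i => ∃ j : Fin N, j ∉ Ω ∧ dist (xc j) (xc i) ≤ 4 with hBd
  have hbd : (Bd.card : ℝ) ≤ 11664 * ρ ^ 2 := card_bdry_four_le hsep (xc i₀) hρone
  have hnle : (Ω.card : ℝ) ≤ (6 * ρ + 1) ^ 3 := card_ball_le hsep i₀ hρpos.le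
  set T := Finset.univ.filter fun i : Fin N => dist (xc i) (xc i₀) ≤ ρ / 2 with hT
  have hTΩ : T ⊆ Ω := by
    intro i hi
    rw [hT, Finset.mem_filter] at hi
    exact Finset.mem_filter.2 ⟨Finset.mem_univ _, by linarith [hi.2]⟩
  have hTcard : (ρ / (4 * r₀)) ^ 3 ≤ (T.card : ℝ) := by
    have hR : 0 ≤ ρ / 2 - r₀ := by linarith
    have hcov : ∀ y : E3, dist y (xc i₀) ≤ ρ / 2 - r₀ →
        ∃ q ∈ Finset.univ.image (xc), dist q y < r₀ := by
      intro y hy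
      obtain ⟨j, hj⟩ := hdense N (xc) i₀ ρ hi₀ y (by linarith)
      exact ⟨xc j, Finset.mem_image_of_mem _ (Finset.mem_univ j), hj⟩
    have hcnt := stub_coverCount r₀ (ρ / 2 - r₀) hr₀ hR (xc i₀) (Finset.univ.image (xc)) hcov
    have himg : ((Finset.univ.image (xc)).filter fun q => dist q (xc i₀) ≤ ρ / 2 - r₀ + r₀) =
        T.image (xc) := by
      rw [hT, Finset.filter_image]
      congr 1
      ext i
      simp
    rw [himg, Finset.card_image_of_injective _ hinj] at hcnt
    have hle : ρ / (4 * r₀) ≤ (ρ / 2 - r₀) / r₀ := by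
      rw [div_le_div_iff₀ (by positivity) hr₀]
      nlinarith [mul_le_mul_of_nonneg_right hρ4r₀ hr₀.le]
    calc (ρ / (4 * r₀)) ^ 3 ≤ ((ρ / 2 - r₀) / r₀) ^ 3 := pow_le_pow_left₀ (by positivity) hle 3
      _ ≤ (T.card : ℝ) := hcnt
  have hnN₀ : N₀ ≤ Ω.card := by
    have hb : (1 : ℝ) ≤ ρ / (4 * r₀) := by
      rw [le_div_iff₀ (by positivity)]; linarith
    have h0 : (N₀ : ℝ) + 1 ≤ ρ / (4 * r₀) := by
      rw [le_div_iff₀ (by positivity)]; linarith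
    have h1 : ρ / (4 * r₀) ≤ (ρ / (4 * r₀)) ^ 3 := by
      calc ρ / (4 * r₀) = (ρ / (4 * r₀)) ^ 1 := (pow_one _).symm
        _ ≤ (ρ / (4 * r₀)) ^ 3 := pow_le_pow_right₀ hb (by norm_num)
    have h2 : (T.card : ℝ) ≤ (Ω.card : ℝ) := by exact_mod_cast Finset.card_le_card hTΩ
    have h3 : (N₀ : ℝ) ≤ (Ω.card : ℝ) := by linarith
    exact_mod_cast h3
  have hEn : groundStateEnergy lennardJones 3 Ω.card ≤ (Ω.card : ℝ) * e + (Ω.card : ℝ) * θ := by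
    have := hN₀ Ω.card hnN₀
    rw [mul_add] at this
    exact this
  have hDle : c * (D.card : ℝ) ≤ θ * (6 * ρ + 1) ^ 3 + C₅ * ρ ^ 2 := by
    have h1 : c * (D.card : ℝ) ≤ (Ω.card : ℝ) * θ + C₄ * ρ ^ 2 + Cnf * (Bd.card : ℝ) := by
      linarith [hnf0, hloc, hEn]
    have h2 : Cnf * (Bd.card : ℝ) ≤ max Cnf 0 * (11664 * ρ ^ 2) :=
      calc Cnf * (Bd.card : ℝ) ≤ max Cnf 0 * (Bd.card : ℝ) :=
            mul_le_mul_of_nonneg_right (le_max_left _ _) (Nat.cast_nonneg _)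
        _ ≤ max Cnf 0 * (11664 * ρ ^ 2) := mul_le_mul_of_nonneg_left hbd (le_max_right _ _)
    have h3 : C₄ * ρ ^ 2 ≤ max C₄ 0 * ρ ^ 2 := mul_le_mul_of_nonneg_right (le_max_left _ _) (by positivity)
    have h4 : (Ω.card : ℝ) * θ ≤ θ * (6 * ρ + 1) ^ 3 := by
      rw [mul_comm]
      exact mul_le_mul_of_nonneg_left hnle hθ0.le
    have h5 : C₅ * ρ ^ 2 = max C₄ 0 * ρ ^ 2 + max Cnf 0 * (11664 * ρ ^ 2) := by rw [hC₅def]; ring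
    rw [h5]
    linarith [h1, h2, h3, h4]
  set Sp := Finset.univ.filter fun i : Fin N => ∃ k ∈ D, dist (xc k) (xc i) ≤ R₀ with hSp
  have hSple : (Sp.card : ℝ) ≤ (6 * R₀ + 1) ^ 3 * (D.card : ℝ) := by
    have := squeeze_card_filter_exists_near_le (by norm_num : (0 : ℝ) < 1 / 3) hR₀0 hsep D
    calc (Sp.card : ℝ) ≤ (2 * R₀ / (1 / 3) + 1) ^ 3 * (D.card : ℝ) := this
      _ = (6 * R₀ + 1) ^ 3 * (D.card : ℝ) := by ring
  have hSplt : (Sp.card : ℝ) < (T.card : ℝ) := by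
    have h1 : (Sp.card : ℝ) ≤ K₁ * (θ * (6 * ρ + 1) ^ 3 + C₅ * ρ ^ 2) :=
      calc (Sp.card : ℝ) ≤ (6 * R₀ + 1) ^ 3 * (D.card : ℝ) := hSple
        _ = K₁ * (c * (D.card : ℝ)) := by rw [hK₁def]; field_simp
        _ ≤ K₁ * (θ * (6 * ρ + 1) ^ 3 + C₅ * ρ ^ 2) := mul_le_mul_of_nonneg_left hDle hK₁.le
    have h67 : (6 * ρ + 1) ^ 3 ≤ 343 * ρ ^ 3 := by
      have h7 : (6 * ρ + 1) ^ 3 ≤ (7 * ρ) ^ 3 := pow_le_pow_left₀ (by positivity) (by linarith) 3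
      have h8 : (7 * ρ) ^ 3 = 343 * ρ ^ 3 := by ring
      linarith
    have h2 : K₁ * (θ * (6 * ρ + 1) ^ 3) ≤ ρ ^ 3 / (128 * r₀ ^ 3) :=
      calc K₁ * (θ * (6 * ρ + 1) ^ 3) ≤ K₁ * (θ * (343 * ρ ^ 3)) :=
            mul_le_mul_of_nonneg_left (mul_le_mul_of_nonneg_left h67 hθ0.le) hK₁.le
        _ = (K₁ * θ * 343) * ρ ^ 3 := by ring
        _ ≤ (1 / (128 * r₀ ^ 3)) * ρ ^ 3 := mul_le_mul_of_nonneg_right hθK (by positivity)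
        _ = ρ ^ 3 / (128 * r₀ ^ 3) := by ring
    have h3 : K₁ * (C₅ * ρ ^ 2) < ρ ^ 3 / (128 * r₀ ^ 3) := by
      rw [lt_div_iff₀ (by positivity)]
      have hA : 128 * r₀ ^ 3 * K₁ * C₅ ≤ ρ - 1 := by linarith
      have hB := mul_le_mul_of_nonneg_right hA (sq_nonneg ρ)
      calc K₁ * (C₅ * ρ ^ 2) * (128 * r₀ ^ 3) = 128 * r₀ ^ 3 * K₁ * C₅ * ρ ^ 2 := by ring
        _ ≤ (ρ - 1) * ρ ^ 2 := hB
        _ < ρ ^ 3 := by nlinarith [sq_nonneg ρ, hρpos]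
    have h4 : ρ ^ 3 / (128 * r₀ ^ 3) + ρ ^ 3 / (128 * r₀ ^ 3) = (ρ / (4 * r₀)) ^ 3 := by
      field_simp
      ring
    calc (Sp.card : ℝ) ≤ K₁ * (θ * (6 * ρ + 1) ^ 3 + C₅ * ρ ^ 2) := h1
      _ = K₁ * (θ * (6 * ρ + 1) ^ 3) + K₁ * (C₅ * ρ ^ 2) := by ring
      _ < ρ ^ 3 / (128 * r₀ ^ 3) + ρ ^ 3 / (128 * r₀ ^ 3) := by linarith
      _ = (ρ / (4 * r₀)) ^ 3 := h4
      _ ≤ (T.card : ℝ) := hTcard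
  obtain ⟨i₁, hi₁T, hi₁Sp⟩ : ∃ i₁ ∈ T, i₁ ∉ Sp := by
    by_contra h
    push Not at h
    have hle : T.card ≤ Sp.card := Finset.card_le_card h
    have : (T.card : ℝ) ≤ (Sp.card : ℝ) := by exact_mod_cast hle
    linarith
  refine ⟨i₁, fun j hj => ?_⟩
  have hi₁c : dist (xc i₁) (xc i₀) ≤ ρ / 2 := (Finset.mem_filter.1 hi₁T).2
  have hjR₀ : dist (xc j) (xc i₁) ≤ R₀ := hj.trans hR'R₀
  have hjΩ : j ∈ Ω := by
    refine Finset.mem_filter.2 ⟨Finset.mem_univ _, ?_⟩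
    have := dist_triangle (xc j) (xc i₁) (xc i₀)
    linarith
  have hjgood : IsTwoShellGood (1 / 20) (47 / 50) 1 (xc) j := hΩgood j hjΩ
  refine ⟨HullBridgeExact.cc_good_of_isTwoShellGood hinj hjgood, ?_⟩
  by_contra hnl
  have hjD : j ∈ D := Finset.mem_filter.2 ⟨hjΩ, hnl⟩
  exact hi₁Sp (Finset.mem_filter.2 ⟨Finset.mem_univ _, j, hjD, hjR₀⟩)


/-- **Clean centres frequently from all-good balls frequently** (the `∃ᶠ N` form of `cleanCentres_of`). -/
theorem cleanCentres_freq_of (hNF : Summit.AtomisticToContinuum.Crystallization.Theses.NashClassCertificates.NashNearField)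
    (x : (N : ℕ) → (Fin N → E3)) (hx : ∀ N, IsGroundState lennardJones (x N))
    (hgood : ∀ ρ : ℝ, ∃ᶠ N : ℕ in atTop, ∃ i : Fin N, ∀ j : Fin N,
      dist (x N j) (x N i) ≤ ρ → IsTwoShellGood (1 / 20) (47 / 50) 1 (x N) j) :
    ∀ η : ℝ, 0 < η → ∀ R' : ℝ, ∃ᶠ N : ℕ in atTop, ∃ i : Fin N, ∀ j : Fin N,
      dist (x N j) (x N i) ≤ R' → Good (x N) j ∧ LayeredNear η (x N) j := by
  intro η hη R'
  obtain ⟨ρ, hρ⟩ := cleanCentre_of_goodBall hNF η hη R'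
  exact (hgood ρ).mono fun N ⟨i₀, hi₀⟩ => hρ N (x N) (hx N) i₀ hi₀

/-! ## One spacing for all scales from windows existing frequently -/
/-- **Choosing one in-layer spacing, frequently version** of `hb_exists_global_spacing`: the same accumulation-point
argument when the `(R, ε)`-windows are only known to exist FREQUENTLY in `N` for every `(R, ε)` (diagonal extraction
by `Filter.extraction_forall_of_frequently`). [folklore] -/
theorem hb_exists_global_spacing_freq (W : ℕ → ℝ → ℝ → Set ℝ)
    (hbox : ∀ N R ε, W N R ε ⊆ Set.Icc (47 / 50 : ℝ) 1)
    (hmono : ∀ N R R₂ ε ε₂, R₂ ≤ R → ε ≤ ε₂ → W N R ε ⊆ W N R₂ ε₂)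
    (hneg : ∀ N R ε a, R < 0 → a ∈ Set.Icc (47 / 50 : ℝ) 1 → a ∈ W N R ε)
    (hresc : ∀ N R ε a a', 0 ≤ R → 0 < ε → a' ∈ W N (2 * R + 1) (ε / 2) →
      a ∈ Set.Icc (47 / 50 : ℝ) 1 → |a - a'| ≤ ε / (8 * (R + 1)) → a ∈ W N R ε)
    (hne : ∀ R ε, 0 < ε → ∃ᶠ N in atTop, (W N R ε).Nonempty) :
    ∃ a ∈ Set.Icc (47 / 50 : ℝ) 1, ∀ R ε, 0 < ε → ∃ᶠ N in atTop, a ∈ W N R ε := by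
  have h1 : ∀ k : ℕ, ∃ᶠ N in atTop, (W N k (1 / ((k : ℝ) + 1))).Nonempty := fun k =>
    hne k _ (by positivity)
  obtain ⟨φ, hφ, hφW⟩ := extraction_forall_of_frequently h1
  choose aseq haseq using hφW
  have hmem : ∀ k, aseq k ∈ Set.Icc (47 / 50 : ℝ) 1 := fun k => hbox _ _ _ (haseq k)
  obtain ⟨a, ha, ψ, hψ, hlim⟩ := isCompact_Icc.tendsto_subseq hmem
  refine ⟨a, ha, fun R ε hε => ?_⟩
  rcases lt_or_ge R 0 with hR | hR
  · exact Eventually.frequently (Eventually.of_forall fun N => hneg N R ε a hR ha)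
  rw [frequently_atTop]
  intro M
  have hκ : 0 < ε / (8 * (R + 1)) := by positivity
  have e1 : ∀ᶠ j in atTop, dist (aseq (ψ j)) a < ε / (8 * (R + 1)) :=
    (Metric.tendsto_nhds.1 hlim) _ hκ
  have hψ' : Tendsto (fun j => ((ψ j : ℕ) : ℝ)) atTop atTop :=
    tendsto_natCast_atTop_atTop.comp hψ.tendsto_atTop
  have e2 : ∀ᶠ j in atTop, 2 * R + 1 ≤ (ψ j : ℝ) := hψ'.eventually_ge_atTop _
  have e3 : ∀ᶠ j in atTop, 2 / ε ≤ (ψ j : ℝ) := hψ'.eventually_ge_atTop _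
  have e4 : ∀ᶠ j in atTop, M ≤ φ (ψ j) := (hφ.comp hψ).tendsto_atTop.eventually_ge_atTop M
  obtain ⟨j, hj1, hj2, hj3, hj4⟩ := (e1.and (e2.and (e3.and e4))).exists
  refine ⟨φ (ψ j), hj4, ?_⟩
  have hmem' : aseq (ψ j) ∈ W (φ (ψ j)) (2 * R + 1) (ε / 2) := by
    refine hmono _ _ _ _ _ hj2 ?_ (haseq (ψ j))
    rw [div_le_iff₀ (by positivity)]
    have h2 : 2 ≤ ε * (ψ j : ℝ) := by
      have := (div_le_iff₀ hε).1 hj3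
      linarith
    nlinarith
  refine hresc _ _ _ _ _ hR hε hmem' ha ?_
  rw [abs_sub_comm, ← Real.dist_eq]
  exact hj1.le

/-- **Windows from gluing, frequently version** of `HullBridgeExact.stub_windowsOfGluing`: clean centres FREQUENTLY in
`N` for every `(η, R')` plus the gluing lemma give ONE in-layer spacing `a ∈ [47/50, 1]` with `(R, ε)`-windows
frequently in `N` for every scale. -/
theorem windowsOfGluing_freq (hG : LayeredGluing) (x : (N : ℕ) → (Fin N → E3))
    (hx : ∀ N, IsGroundState lennardJones (x N))
    (hcentre : ∀ η : ℝ, 0 < η → ∀ R' : ℝ, ∃ᶠ N : ℕ in atTop, ∃ i : Fin N, ∀ j : Fin N,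
      dist (x N j) (x N i) ≤ R' → Good (x N) j ∧ LayeredNear η (x N) j) :
    ∃ a : ℝ, 47 / 50 ≤ a ∧ a ≤ 1 ∧ ∀ R ε : ℝ, 0 < ε → ∃ᶠ N in Filter.atTop,
      ∃ (A : E3 →ₗᵢ[ℝ] E3) (t : E3) (s : ℤ → ℤ) (z : ℤ → ℝ), IsHaggSeq s ∧
        (∀ m : ℤ, 39 / 50 * a ≤ z (m + 1) - z m ∧ z (m + 1) - z m ≤ 17 / 20 * a) ∧
        let S : Set E3 := {p | ∃ m i j : ℤ, p = A (((i : ℝ) • triangularVec₁ a) +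
          ((j : ℝ) • triangularVec₂ a) + ((haggLabel s m : ℝ) • barlowOffset a) + (z m • layerNormal 1))}
        (∀ p ∈ S, ‖p‖ ≤ R → ∃ i : Fin N, dist (x N i + t) p ≤ ε) ∧
          (∀ i : Fin N, ‖x N i + t‖ ≤ R → ∃ p ∈ S, dist (x N i + t) p ≤ ε) := by
  -- the set of admissible spacings of `(R, ε)`-windows of `x N`
  let W : ℕ → ℝ → ℝ → Set ℝ := fun N R ε =>
    {a | a ∈ Set.Icc (47 / 50 : ℝ) 1 ∧
      ∃ (A : E3 →ₗᵢ[ℝ] E3) (t : E3) (s : ℤ → ℤ) (z : ℤ → ℝ), IsHaggSeq s ∧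
        (∀ m : ℤ, 39 / 50 * a ≤ z (m + 1) - z m ∧ z (m + 1) - z m ≤ 17 / 20 * a) ∧
        let S : Set E3 := {p | ∃ m i j : ℤ, p = A (((i : ℝ) • triangularVec₁ a) +
          ((j : ℝ) • triangularVec₂ a) + ((haggLabel s m : ℝ) • barlowOffset a) +
          (z m • layerNormal 1))}
        (∀ p ∈ S, ‖p‖ ≤ R → ∃ i : Fin N, dist (x N i + t) p ≤ ε) ∧
          (∀ i : Fin N, ‖x N i + t‖ ≤ R → ∃ p ∈ S, dist (x N i + t) p ≤ ε)}
  have hbox : ∀ N R ε, W N R ε ⊆ Set.Icc (47 / 50 : ℝ) 1 := fun N R ε a ha => ha.1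
  have hmono : ∀ N R R₂ ε ε₂, R₂ ≤ R → ε ≤ ε₂ → W N R ε ⊆ W N R₂ ε₂ :=
    fun N R R₂ ε ε₂ hR hε a ha => ⟨ha.1, hb_window_mono (x N) hR hε ha.2⟩
  have hneg : ∀ N R ε a, R < 0 → a ∈ Set.Icc (47 / 50 : ℝ) 1 → a ∈ W N R ε :=
    fun N R ε a hR ha => ⟨ha, hb_window_neg (x N) hR (by linarith [ha.1])⟩
  have hresc : ∀ N R ε a a', 0 ≤ R → 0 < ε → a' ∈ W N (2 * R + 1) (ε / 2) →
      a ∈ Set.Icc (47 / 50 : ℝ) 1 → |a - a'| ≤ ε / (8 * (R + 1)) → a ∈ W N R ε :=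
    fun N R ε a a' hR hε ha' ha haa =>
      ⟨ha, hb_window_rescale (x N) hR hε ha.1 ha.2 ha'.1.1 ha'.1.2 haa ha'.2⟩
  have hne : ∀ R ε, 0 < ε → ∃ᶠ N in atTop, (W N R ε).Nonempty := by
    intro R ε hε
    obtain ⟨δ, hδ, hsepall⟩ := LennardJonesMinimalDistance_holds
    obtain ⟨η, hη, R', hglue⟩ := hG δ hδ R ε hε
    refine (hcentre η hη R').mono fun N ⟨i, hi⟩ => ?_
    obtain ⟨A, t, a, s, z, hbox', hs, h12⟩ := hglue N (x N) (hsepall N (x N) (hx N)) i hi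
    dsimp only at h12
    rw [HullBridgeExact.wg_range_layeredPos_eq] at h12
    exact ⟨a, ⟨hbox'.1, hbox'.2.1⟩, A, t, s, z, hs, hbox'.2.2, h12⟩
  obtain ⟨a, ha, hwin⟩ := hb_exists_global_spacing_freq W hbox hmono hneg hresc hne
  exact ⟨a, ha.1, ha.2, fun R ε hε => (hwin R ε hε).mono fun N hN => hN.2⟩

/-! ## The bridge from the frequently form of S1 -/
/-- **Layered windows of a ground-state sequence from all-good balls FREQUENTLY** (plus `NashNearField`). -/
theorem layeredWindows_seq_of_goodWindows_freq
    (hNF : Summit.AtomisticToContinuum.Crystallization.Theses.NashClassCertificates.NashNearField)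
    (x : (N : ℕ) → (Fin N → E3)) (hx : ∀ N, IsGroundState lennardJones (x N))
    (hgood : ∀ ρ : ℝ, ∃ᶠ N : ℕ in atTop, ∃ i : Fin N, ∀ j : Fin N,
      dist (x N j) (x N i) ≤ ρ → IsTwoShellGood (1 / 20) (47 / 50) 1 (x N) j) :
    ∃ a : ℝ, 47 / 50 ≤ a ∧ a ≤ 1 ∧ ∀ R ε : ℝ, 0 < ε → ∃ᶠ N in Filter.atTop,
      ∃ (A : E3 →ₗᵢ[ℝ] E3) (t : E3) (s : ℤ → ℤ) (z : ℤ → ℝ), IsHaggSeq s ∧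
        (∀ m : ℤ, 39 / 50 * a ≤ z (m + 1) - z m ∧ z (m + 1) - z m ≤ 17 / 20 * a) ∧
        let S : Set E3 := {p | ∃ m i j : ℤ, p = A (((i : ℝ) • triangularVec₁ a) +
          ((j : ℝ) • triangularVec₂ a) + ((haggLabel s m : ℝ) • barlowOffset a) + (z m • layerNormal 1))}
        (∀ p ∈ S, ‖p‖ ≤ R → ∃ i : Fin N, dist (x N i + t) p ≤ ε) ∧
          (∀ i : Fin N, ‖x N i + t‖ ≤ R → ∃ p ∈ S, dist (x N i + t) p ≤ ε) :=
  windowsOfGluing_freq stub_layeredGluing x hx (cleanCentres_freq_of hNF x hx hgood)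

/-- **`LayeredWindows` (stmt-11778) from the FREQUENTLY form of the positional leaf and the Nash near field**:
if along every ground-state sequence all-two-shell-good balls of every radius exist frequently in `N`, then
`NashNearField → HullMinimality.LayeredWindows`. -/
theorem layeredWindows_of_goodWindows_freq : (∀ x : (N : ℕ) → (Fin N → EuclideanSpace ℝ (Fin 3)), (∀ N, Literature.MathematicalPhysics.StatisticalMechanics.IsGroundState Literature.MathematicalPhysics.StatisticalMechanics.lennardJones (x N)) → ∀ ρ : ℝ, ∃ᶠ N : ℕ in Filter.atTop, ∃ i : Fin N, ∀ j : Fin N, dist (x N j) (x N i) ≤ ρ → Literature.Geometry.DiscreteGeometry.IsTwoShellGood (1 / 20) (47 / 50) 1 (x N) j) → Summit.AtomisticToContinuum.Crystallization.Theses.NashClassCertificates.NashNearField → Summit.AtomisticToContinuum.Crystallization.Theses.HullMinimality.LayeredWindows :=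
  fun hgood hNF x hx => layeredWindows_seq_of_goodWindows_freq hNF x hx (hgood x hx)

end Summit.AtomisticToContinuum.Crystallization.Theorems.LayeredWindowsLocal

end
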